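import Mathlib
import HarnessLib
import Literature.MathematicalPhysics.QuantumManyBody.PeriodicFormDomain
import Summits.AtomisticToContinuum.BoseEinsteinCondensation.Theorems.BECConjugateDominationInfraredMinimumUncertaintyWeakEulerLagrange

/-!
# Route `BECFisherTransfer` — support `TrialDriftFisherBound` (stmt-AtomisticToContinuum-14306):
# the weak Euler–Lagrange equation of a periodic minimiser under an integrable interaction

Helper file for `Summit.AtomisticToContinuum.BoseEinsteinCondensation.Theses.BECFisherTransfer.TrialDriftFisherBound`.
The sibling file `…InfraredMinimumUncertaintyWeakEulerLagrange.lean` (route `BECConjugateDomination`)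
proves the weak Euler–Lagrange (eigen-)equation of a finite-energy minimiser of the periodic `N`-body
energy in the `C¹` periodic Bose class under a *bounded* periodised interaction. Here the same
Rayleigh–Ritz first-variation argument is run under the weaker hypothesis that the interaction is
*integrable on the fundamental cell*, `∫_{cell^N} W < ∞` (`W = ∑_{i<j} v^per(xᵢ - xⱼ)`), which is
automatic for a finite-energy state bounded below in modulus by a positive constant on the cell
(`lintegral_interaction_ne_top`) — in particular for the positive minimisers `Ψ₀ > 0` of item
`TrialDriftFisherBound`, for *every* repulsive finite-range `v` (no boundedness or continuity of `v`
is needed): for every `C¹`, `Lℤ³`-periodic, Bose-symmetric `η`,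
`Re ∫_{cell^N} (∑_{i,k} conj(∂_{i,k}η) ∂_{i,k}Ψ + W conj(η) Ψ) = E₀ · Re ∫_{cell^N} conj(η) Ψ`
(`firstVariation_eq'`).

References: [ReedSimonIV1978] §XIII.1 (Rayleigh–Ritz); [Fournais2020] (1.1)–(1.2).
-/

noncomputable section

open MeasureTheory Filter Set
open scoped ENNReal NNReal Topology ComplexConjugate BigOperators

namespace Summit.AtomisticToContinuum.BoseEinsteinCondensation.Theorems

open Literature.MathematicalPhysics.QuantumManyBody.BoseGas

namespace TrialDriftFisher

open ImuWeakEulerLagrange (eq_zero_of_forall_quadratic_nonneg norm_sq_add_ofReal_mul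
  lintegral_nnnorm_sq_eq_ofReal integral_norm_sq_add_mul)

variable {N : ℕ} {L : ℝ} {v : ℝ → ℝ≥0∞}

/-! ### Positive states: a positive floor on the cell, and integrability of the interaction -/

/-- A continuous function on `(ℝ³)^N` that is positive everywhere is bounded below by a positive
constant on the (bounded) fundamental cell. [folklore] -/
theorem exists_pos_le_on_cellN {f : Config N → ℝ} (hf : Continuous f) (hpos : ∀ X, 0 < f X)
    (L : ℝ) : ∃ m : ℝ, 0 < m ∧ ∀ X ∈ cellN N L, m ≤ f X := by
  obtain ⟨X₀, _, hX₀⟩ := (isCompact_closedBall (0 : Config N) (2 * |L|)).exists_isMinOn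
    ⟨0, Metric.mem_closedBall_self (by positivity)⟩ hf.continuousOn
  exact ⟨f X₀, hpos X₀, fun X hX => hX₀ (cellN_subset_closedBall N L hX)⟩

/-- If a state of finite periodic energy is bounded below in modulus by `m > 0` on the cell, the
periodic interaction is integrable on the cell: `m² ∫_{cell} W ≤ ∫_{cell} W |Ψ|² ≤ ⟨Ψ,HΨ⟩ < ∞`.
[folklore] -/
theorem lintegral_interaction_ne_top (hvm : Measurable v) (Ψ : PeriodicTrialState N L)
    (hfin : periodicEnergy v Ψ ≠ ⊤) {m : ℝ} (hm : 0 < m) (hmle : ∀ X ∈ cellN N L, m ≤ ‖Ψ.ψ X‖) :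
    ∫⁻ X in cellN N L, periodicInteraction v L X ≠ ⊤ := by
  have h1 : ∫⁻ X in cellN N L, periodicInteraction v L X * (‖Ψ.ψ X‖₊ : ℝ≥0∞) ^ 2 ≤
      periodicEnergy v Ψ := lintegral_mono fun X => le_add_self
  have h2 : ∫⁻ X in cellN N L, ENNReal.ofReal (m ^ 2) * periodicInteraction v L X ≤
      ∫⁻ X in cellN N L, periodicInteraction v L X * (‖Ψ.ψ X‖₊ : ℝ≥0∞) ^ 2 := by
    refine setLIntegral_mono' (measurableSet_cellN N L) fun X hX => ?_
    rw [mul_comm]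
    refine mul_le_mul' le_rfl ?_
    rw [coe_nnnorm_sq_eq_ofReal]
    exact ENNReal.ofReal_le_ofReal (pow_le_pow_left₀ hm.le (hmle X hX) 2)
  rw [lintegral_const_mul _ (measurable_periodicInteraction hvm L)] at h2
  intro htop
  rw [htop, ENNReal.mul_top (by positivity)] at h2
  exact hfin (top_le_iff.mp (h2.trans h1))

/-! ### Real (Bochner) forms of the cell integrals under an integrable interaction -/

/-- An interaction integrable on the cell times a continuous function is integrable on the
(bounded) fundamental cell. [folklore] -/
theorem integrableOn_toReal_interaction_mul' (hvm : Measurable v)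
    (hW : ∫⁻ X in cellN N L, periodicInteraction v L X ≠ ⊤) {g : Config N → ℝ}
    (hg : Continuous g) :
    IntegrableOn (fun X => (periodicInteraction v L X).toReal * g X) (cellN N L) := by
  obtain ⟨C, hC⟩ := (isCompact_closedBall (0 : Config N) (2 * |L|)).exists_bound_of_continuousOn
    hg.continuousOn
  have hWi : IntegrableOn (fun X => (periodicInteraction v L X).toReal) (cellN N L) :=
    integrable_toReal_of_lintegral_ne_top (measurable_periodicInteraction hvm L).aemeasurable hW
  refine Integrable.mul_bdd (c := C) hWi hg.aestronglyMeasurable ?_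
  rw [ae_restrict_iff' (measurableSet_cellN N L)]
  exact ae_of_all _ fun X hX => hC X (cellN_subset_closedBall N L hX)

/-- The form `⟨Φ, HΦ⟩ = ∫⁻ (|∇Φ|² + W|Φ|²)` of a `C¹` function under an interaction integrable on the
cell, in real form: `= ofReal ∫ (|∇Φ|² + W.toReal |Φ|²)` (`W < ∞` a.e. on the cell,
`ae_periodicInteraction_lt_top` of `PeriodicFormDomain.lean`). [cite: Fournais2020, (1.1)] -/
theorem periodicForm_eq_ofReal' (hvm : Measurable v)
    (hW : ∫⁻ X in cellN N L, periodicInteraction v L X ≠ ⊤) {Φ : Config N → ℂ}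
    (hΦ : ContDiff ℝ 1 Φ) :
    ∫⁻ X in cellN N L, (kineticDensity Φ X + periodicInteraction v L X * (‖Φ X‖₊ : ℝ≥0∞) ^ 2) =
      ENNReal.ofReal (∫ X in cellN N L,
        (kineticDensityReal Φ X + (periodicInteraction v L X).toReal * ‖Φ X‖ ^ 2)) := by
  have hint : IntegrableOn (fun X => kineticDensityReal Φ X +
      (periodicInteraction v L X).toReal * ‖Φ X‖ ^ 2) (cellN N L) :=
    (integrableOn_cellN (continuous_kineticDensityReal hΦ) L).add
      (integrableOn_toReal_interaction_mul' hvm hW (hΦ.continuous.norm.pow 2))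
  rw [ofReal_integral_eq_lintegral_ofReal hint (ae_of_all _ fun X =>
    add_nonneg (kineticDensityReal_nonneg Φ X) (mul_nonneg ENNReal.toReal_nonneg (sq_nonneg _)))]
  refine lintegral_congr_ae ?_
  filter_upwards [ae_periodicInteraction_lt_top hvm hW] with X hX
  rw [ENNReal.ofReal_add (kineticDensityReal_nonneg Φ X)
      (mul_nonneg ENNReal.toReal_nonneg (sq_nonneg _)),
    kineticDensity_eq_ofReal, ENNReal.ofReal_mul ENNReal.toReal_nonneg,
    ENNReal.ofReal_toReal hX.ne, coe_nnnorm_sq_eq_ofReal]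

/-- Real form of the variational principle for an unnormalised `C¹`, `Lℤ³`-periodic, Bose-symmetric
`φ` under an interaction integrable on the cell and `E₀ < ∞`: `E₀ ∫|φ|² ≤ ∫ (|∇φ|² + W|φ|²)`.
[cite: Fournais2020, (1.1)–(1.2)] -/
theorem toReal_groundStateEnergy_mul_le' (hvm : Measurable v)
    (hW : ∫⁻ X in cellN N L, periodicInteraction v L X ≠ ⊤)
    (hE : periodicGroundStateEnergy v N L ≠ ⊤) {φ : Config N → ℂ} (hφ : ContDiff ℝ 1 φ)
    (hper : ∀ (X : Config N) (i : Fin N) (k : Fin 3),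
      φ (X + Pi.single i (EuclideanSpace.single k L)) = φ X)
    (hsymm : ∀ (σ : Equiv.Perm (Fin N)) (X : Config N), φ (X ∘ σ) = φ X) :
    (periodicGroundStateEnergy v N L).toReal * ∫ X in cellN N L, ‖φ X‖ ^ 2 ≤
      ∫ X in cellN N L,
        (kineticDensityReal φ X + (periodicInteraction v L X).toReal * ‖φ X‖ ^ 2) := by
  have h := periodicGroundStateEnergy_mul_normSq_le v hφ hper hsymm
  rw [lintegral_nnnorm_sq_eq_ofReal hφ.continuous, periodicForm_eq_ofReal' hvm hW hφ,
    ← ENNReal.ofReal_toReal hE, ← ENNReal.ofReal_mul ENNReal.toReal_nonneg,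
    ENNReal.ofReal_le_ofReal_iff (integral_nonneg fun X => add_nonneg
      (kineticDensityReal_nonneg φ X) (mul_nonneg ENNReal.toReal_nonneg (sq_nonneg _)))] at h
  exact h

/-- Second-order expansion of the form along `φ + tη` under an interaction integrable on the cell:
`⟨φ + tη, H(φ + tη)⟩ = ⟨φ, Hφ⟩ + 2t Re⟨η, Hφ⟩ + t² ⟨η, Hη⟩` in real (weak) form. [folklore] -/
theorem integral_form_add_mul' (hvm : Measurable v)
    (hW : ∫⁻ X in cellN N L, periodicInteraction v L X ≠ ⊤)
    {φ η : Config N → ℂ} (hφ : ContDiff ℝ 1 φ) (hη : ContDiff ℝ 1 η) (t : ℝ) :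
    ∫ X in cellN N L, (kineticDensityReal (fun Y => φ Y + (t : ℂ) * η Y) X +
        (periodicInteraction v L X).toReal * ‖φ X + (t : ℂ) * η X‖ ^ 2) =
      (∫ X in cellN N L,
          (kineticDensityReal φ X + (periodicInteraction v L X).toReal * ‖φ X‖ ^ 2)) +
        2 * t * (∫ X in cellN N L,
          ((∑ i : Fin N, ∑ k : Fin 3,
              (conj (fderiv ℝ η X (Pi.single i (EuclideanSpace.single k (1 : ℝ)))) *
                fderiv ℝ φ X (Pi.single i (EuclideanSpace.single k (1 : ℝ)))).re) +
            (periodicInteraction v L X).toReal * (conj (η X) * φ X).re)) +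
        t ^ 2 * ∫ X in cellN N L,
          (kineticDensityReal η X + (periodicInteraction v L X).toReal * ‖η X‖ ^ 2) := by
  -- adapted from `ImuWeakEulerLagrange.integral_form_add_mul`
  have hφd := hφ.differentiable one_ne_zero
  have hηd := hη.differentiable one_ne_zero
  have hD : ∀ X, fderiv ℝ (fun Y => φ Y + (t : ℂ) * η Y) X =
      fderiv ℝ φ X + (t : ℂ) • fderiv ℝ η X := fun X => by
    rw [fderiv_fun_add (hφd X) ((hηd X).const_mul _), fderiv_const_mul (hηd X)]
  have hkin : ∀ X, kineticDensityReal (fun Y => φ Y + (t : ℂ) * η Y) X =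
      kineticDensityReal φ X + 2 * t * (∑ i : Fin N, ∑ k : Fin 3,
        (conj (fderiv ℝ η X (Pi.single i (EuclideanSpace.single k (1 : ℝ)))) *
          fderiv ℝ φ X (Pi.single i (EuclideanSpace.single k (1 : ℝ)))).re) +
        t ^ 2 * kineticDensityReal η X := by
    intro X
    simp only [kineticDensityReal, hD, add_apply, smul_apply, smul_eq_mul,
      norm_sq_add_ofReal_mul, Finset.sum_add_distrib, Finset.mul_sum]
  have hpt : ∀ X, kineticDensityReal (fun Y => φ Y + (t : ℂ) * η Y) X +
      (periodicInteraction v L X).toReal * ‖φ X + (t : ℂ) * η X‖ ^ 2 =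
      (kineticDensityReal φ X + (periodicInteraction v L X).toReal * ‖φ X‖ ^ 2) +
        2 * t * ((∑ i : Fin N, ∑ k : Fin 3,
            (conj (fderiv ℝ η X (Pi.single i (EuclideanSpace.single k (1 : ℝ)))) *
              fderiv ℝ φ X (Pi.single i (EuclideanSpace.single k (1 : ℝ)))).re) +
          (periodicInteraction v L X).toReal * (conj (η X) * φ X).re) +
        t ^ 2 * (kineticDensityReal η X + (periodicInteraction v L X).toReal * ‖η X‖ ^ 2) := by
    intro X
    rw [hkin X, norm_sq_add_ofReal_mul]
    ring
  simp_rw [hpt]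
  have hcK : Continuous fun X => ∑ i : Fin N, ∑ k : Fin 3,
      (conj (fderiv ℝ η X (Pi.single i (EuclideanSpace.single k (1 : ℝ)))) *
        fderiv ℝ φ X (Pi.single i (EuclideanSpace.single k (1 : ℝ)))).re := by
    have h1 := hφ.continuous_fderiv one_ne_zero
    have h2 := hη.continuous_fderiv one_ne_zero
    fun_prop
  have i0 : IntegrableOn (fun X => kineticDensityReal φ X +
      (periodicInteraction v L X).toReal * ‖φ X‖ ^ 2) (cellN N L) :=
    (integrableOn_cellN (continuous_kineticDensityReal hφ) L).add
      (integrableOn_toReal_interaction_mul' hvm hW (hφ.continuous.norm.pow 2))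
  have i1 : IntegrableOn (fun X => (∑ i : Fin N, ∑ k : Fin 3,
      (conj (fderiv ℝ η X (Pi.single i (EuclideanSpace.single k (1 : ℝ)))) *
        fderiv ℝ φ X (Pi.single i (EuclideanSpace.single k (1 : ℝ)))).re) +
      (periodicInteraction v L X).toReal * (conj (η X) * φ X).re) (cellN N L) :=
    (integrableOn_cellN hcK L).add (integrableOn_toReal_interaction_mul' hvm hW
      (Complex.continuous_re.comp ((Complex.continuous_conj.comp hη.continuous).mul hφ.continuous)))
  have i2 : IntegrableOn (fun X => kineticDensityReal η X +
      (periodicInteraction v L X).toReal * ‖η X‖ ^ 2) (cellN N L) :=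
    (integrableOn_cellN (continuous_kineticDensityReal hη) L).add
      (integrableOn_toReal_interaction_mul' hvm hW (hη.continuous.norm.pow 2))
  have hA : Integrable (fun X => (kineticDensityReal φ X +
      (periodicInteraction v L X).toReal * ‖φ X‖ ^ 2) + 2 * t * ((∑ i : Fin N, ∑ k : Fin 3,
        (conj (fderiv ℝ η X (Pi.single i (EuclideanSpace.single k (1 : ℝ)))) *
          fderiv ℝ φ X (Pi.single i (EuclideanSpace.single k (1 : ℝ)))).re) +
      (periodicInteraction v L X).toReal * (conj (η X) * φ X).re)) (volume.restrict (cellN N L)) :=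
    i0.add (i1.const_mul _)
  rw [integral_add hA (i2.const_mul _), integral_add i0 (i1.const_mul _),
    integral_const_mul, integral_const_mul]

/-- **First variation of the Rayleigh quotient at a minimiser (weak Euler–Lagrange equation)**,
under an interaction integrable on the cell. If `Ψ` attains `E₀ = inf ⟨Φ, HΦ⟩/‖Φ‖²` over the `C¹`
periodic Bose class with `E₀ < ∞`, then `Re⟨η, (H - E₀)Ψ⟩ = 0` in weak form for every `C¹` periodic
Bose-symmetric `η`. [cite: ReedSimonIV1978, §XIII.1] -/
theorem firstVariation_eq' (hvm : Measurable v)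
    (hW : ∫⁻ X in cellN N L, periodicInteraction v L X ≠ ⊤) (Ψ : PeriodicTrialState N L)
    (hmin : periodicEnergy v Ψ = periodicGroundStateEnergy v N L) (hfin : periodicEnergy v Ψ ≠ ⊤)
    {η : Config N → ℂ} (hη : ContDiff ℝ 1 η)
    (hper : ∀ (X : Config N) (i : Fin N) (k : Fin 3),
      η (X + Pi.single i (EuclideanSpace.single k L)) = η X)
    (hsymm : ∀ (σ : Equiv.Perm (Fin N)) (X : Config N), η (X ∘ σ) = η X) :
    (∫ X in cellN N L,
        ((∑ i : Fin N, ∑ k : Fin 3,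
            (conj (fderiv ℝ η X (Pi.single i (EuclideanSpace.single k (1 : ℝ)))) *
              fderiv ℝ Ψ.ψ X (Pi.single i (EuclideanSpace.single k (1 : ℝ)))).re) +
          (periodicInteraction v L X).toReal * (conj (η X) * Ψ.ψ X).re)) =
      (periodicGroundStateEnergy v N L).toReal * ∫ X in cellN N L, (conj (η X) * Ψ.ψ X).re := by
  -- adapted from `ImuWeakEulerLagrange.firstVariation_eq`
  have hE : periodicGroundStateEnergy v N L ≠ ⊤ := hmin ▸ hfin
  -- the form and the mass at `Ψ`
  have hF : ∫ X in cellN N L, (kineticDensityReal Ψ.ψ X +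
      (periodicInteraction v L X).toReal * ‖Ψ.ψ X‖ ^ 2) =
        (periodicGroundStateEnergy v N L).toReal := by
    have h1 : periodicEnergy v Ψ = ENNReal.ofReal (∫ X in cellN N L, (kineticDensityReal Ψ.ψ X +
        (periodicInteraction v L X).toReal * ‖Ψ.ψ X‖ ^ 2)) :=
      periodicForm_eq_ofReal' hvm hW Ψ.contDiff
    rw [← hmin, h1, ENNReal.toReal_ofReal (integral_nonneg fun X => add_nonneg
      (kineticDensityReal_nonneg _ X) (mul_nonneg ENNReal.toReal_nonneg (sq_nonneg _)))]
  have hM : ∫ X in cellN N L, ‖Ψ.ψ X‖ ^ 2 = 1 := by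
    have h1 := lintegral_nnnorm_sq_eq_ofReal Ψ.contDiff.continuous L
    rw [Ψ.norm_eq] at h1
    rw [← ENNReal.toReal_ofReal (integral_nonneg fun X => sq_nonneg ‖Ψ.ψ X‖), ← h1,
      ENNReal.toReal_one]
  -- the variational inequality along `Ψ + tη`, expanded to second order in `t`
  have hineq : ∀ t : ℝ, (periodicGroundStateEnergy v N L).toReal *
      ((∫ X in cellN N L, ‖Ψ.ψ X‖ ^ 2) + 2 * t * (∫ X in cellN N L, (conj (η X) * Ψ.ψ X).re) +
        t ^ 2 * ∫ X in cellN N L, ‖η X‖ ^ 2) ≤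
      (∫ X in cellN N L,
          (kineticDensityReal Ψ.ψ X + (periodicInteraction v L X).toReal * ‖Ψ.ψ X‖ ^ 2)) +
        2 * t * (∫ X in cellN N L, ((∑ i : Fin N, ∑ k : Fin 3,
            (conj (fderiv ℝ η X (Pi.single i (EuclideanSpace.single k (1 : ℝ)))) *
              fderiv ℝ Ψ.ψ X (Pi.single i (EuclideanSpace.single k (1 : ℝ)))).re) +
          (periodicInteraction v L X).toReal * (conj (η X) * Ψ.ψ X).re)) +
        t ^ 2 * ∫ X in cellN N L,
          (kineticDensityReal η X + (periodicInteraction v L X).toReal * ‖η X‖ ^ 2) := by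
    intro t
    have hC : ContDiff ℝ 1 fun Y => Ψ.ψ Y + (t : ℂ) * η Y :=
      Ψ.contDiff.add (contDiff_const.mul hη)
    have hP : ∀ (X : Config N) (i : Fin N) (k : Fin 3),
        (fun Y => Ψ.ψ Y + (t : ℂ) * η Y) (X + Pi.single i (EuclideanSpace.single k L)) =
          (fun Y => Ψ.ψ Y + (t : ℂ) * η Y) X := fun X i k => by
      simp only [Ψ.periodic, hper]
    have hS : ∀ (σ : Equiv.Perm (Fin N)) (X : Config N),
        (fun Y => Ψ.ψ Y + (t : ℂ) * η Y) (X ∘ σ) = (fun Y => Ψ.ψ Y + (t : ℂ) * η Y) X :=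
      fun σ X => by simp only [Ψ.symm, hsymm]
    have h := toReal_groundStateEnergy_mul_le' hvm hW hE hC hP hS
    rw [integral_norm_sq_add_mul Ψ.contDiff.continuous hη.continuous,
      integral_form_add_mul' hvm hW Ψ.contDiff hη] at h
    exact h
  rw [hF, hM] at hineq
  refine sub_eq_zero.mp (eq_zero_of_forall_quadratic_nonneg
    (a := (∫ X in cellN N L,
        (kineticDensityReal η X + (periodicInteraction v L X).toReal * ‖η X‖ ^ 2)) -
      (periodicGroundStateEnergy v N L).toReal * ∫ X in cellN N L, ‖η X‖ ^ 2) fun t => ?_)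
  have h := hineq t
  linarith

end TrialDriftFisher

end Summit.AtomisticToContinuum.BoseEinsteinCondensation.Theorems

end
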